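import Summits.ABC.StewartYu.PadicG3PackClosedHalf
import Summits.ABC.StewartYu.PadicG3FrameOdd
import Summits.ABC.StewartYu.PadicG3ParGA
import HarnessLib

/-!
# Cell abc-stewartyu, crux `Y07Odd` (stmt-ABC-19658), line `gen3-slab-odd`: the v2 record schedule INSTANTIATED in the frame's currency
# (plan g8 owner ruling 2026-08-27T03:15Z: p2 = STRUCTURE) — nodes, orders, multiplicities, box, cardinal and size bounds from `PadicG3ParG`

`Summits/ABC/StewartYu/PadicG3ScheduleG.lean` — cell `abc-stewartyu` (seat p2-g4, F-odd lead).  Definitions (functions of a datum `S` and a parameter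
record `P : PadicG3Par S.n`) and theorems; no named fact; NO inequality between the record's real parameters is proved here (p1's part).

* `sideG j = ⌊LG/(4Aⱼ)⌋` (box half-sides; output box `2·Lb side ŜG ≤ DG` needs `Nq ≥ 1` only), `NG lev ν = 2^ν·XsG lev` (symmetric node ranges),
  `NhG lev = XsG lev` (odd ranges `2·XsG − 1`), `tK lev = TG lev + 1` (jets), `remG`/`TordG lev ν = MordG lev ν + #remaining transitions`
  (orders: the extra `+1` per transition pays the frame's `T′ + t ≤ T` bookkeeping so that the record's decrement stays `TG`, Nesterenko's (4.5));
* `TordG_kstep`, `TordG_half` — the order conditions of the steps hold by `MordG_sub_succ` / `MordG_level`;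
* `UcardC` (`#unk L₀ 𝔏 ≤ (L₀G+1)∏(2 sideⱼ+1)`), monotonicity `monDen_mono`, `M0C_mono`, `KC_mono`.

References: Yu. V. Nesterenko, LNM 1819 (2003) (4.3)–(4.5); cell pages HOME/p1/K-M3.2-m0-branch.md, HOME/p2/SETUP3-SPEC.md.
-/

noncomputable section

open NormedSpace Finset Polynomial
open Literature.NumberTheory.Transcendental
open Literature.NumberTheory.Transcendental.CW77.Setup (Tau tauNorm)
open scoped Nat

namespace Summit.ABC.StewartYu

namespace G3Setup

variable {p : ℕ} [Fact p.Prime] (S : G3Setup p) (P : PadicG3Par S.n)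

/-! ### The schedule in the frame's currency -/

/-- Box half-sides `⌊LG/(4Aⱼ)⌋`. [cite: Nesterenko2003, §3.4; shape only] -/
def sideG (j : Fin S.n) : ℕ := ⌊(P.LG : ℝ) / (4 * P.A j)⌋₊

/-- Symmetric node ranges `2^ν · XsG lev`. [cite: Nesterenko2003, (4.3)] -/
def NG (lev ν : ℕ) : ℕ := 2 ^ ν * P.XsG lev

/-- Odd node ranges: odd `|x| ≤ 2·XsG lev − 1`. [cite: Nesterenko2003, (4.3)] -/
def NhG (lev : ℕ) : ℕ := P.XsG lev

/-- Jets per node `TG lev + 1`. [cite: Nesterenko2003, Lemma 4.3] -/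
def tK (lev : ℕ) : ℕ := P.TG lev + 1

/-- Transitions remaining after state `(lev, ν)`. [folklore] -/
def remG (lev ν : ℕ) : ℕ := (P.SdG - lev) * (S.n + 1) + (S.n - ν)

/-- Orders of the state `(lev, ν)`: `MordG lev ν + remG lev ν`. [cite: Nesterenko2003, (4.5); shape only] -/
def TordG (lev ν : ℕ) : ℕ := P.MordG lev ν + S.remG P lev ν

/-- `1 ≤ tK`. [folklore] -/
theorem one_le_tK (lev : ℕ) : 1 ≤ S.tK P lev := by unfold tK; omega

/-- **Order condition of a k-step**: `TordG lev (ν+1) + tK lev ≤ TordG lev ν` for `ν < n`. [cite: Nesterenko2003, (4.5)] -/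
theorem TordG_kstep (lev ν : ℕ) (hν : ν < S.n) : S.TordG P lev (ν + 1) + S.tK P lev ≤ S.TordG P lev ν := by
  unfold TordG tK remG
  have h := P.MordG_sub_succ lev ν hν.le
  have : S.n - ν = (S.n - (ν + 1)) + 1 := by omega
  rw [h, this]
  omega

/-- **Order condition of the half-step**: `TordG (lev+1) 0 + tK lev ≤ TordG lev n` for `lev + 1 ≤ ŜG`. [cite: Nesterenko2003, (4.5)] -/
theorem TordG_half (lev : ℕ) (hlev : lev + 1 ≤ P.SdG) : S.TordG P (lev + 1) 0 + S.tK P lev ≤ S.TordG P lev S.n := by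
  unfold TordG tK remG
  have h1 := P.MordG_sub_succ lev S.n le_rfl
  have h2 := P.MordG_level lev hlev
  have h3 : (P.SdG - lev) * (S.n + 1) = (P.SdG - (lev + 1)) * (S.n + 1) + (S.n + 1) := by
    have : P.SdG - lev = (P.SdG - (lev + 1)) + 1 := by omega
    rw [this]; ring
  rw [h1, h2, h3]
  simp only [Nat.sub_self, Nat.sub_zero, add_zero]
  omega

/-! ### Cardinal of the unknowns -/

/-- `#unk L₀G 𝔏 ≤ (L₀G+1)·∏(2 sideⱼ + 1)` for `𝔏 ⊆ box side`. [folklore] -/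
def UcardC : ℕ := (P.L0G + 1) * ∏ j, (2 * S.sideG P j + 1)

/-- The bound. [folklore] -/
theorem card_unk_le_UcardC {𝔏 : Finset (Fin S.n → ℤ)} (h𝔏 : 𝔏 ⊆ S.box (S.sideG P)) : (S.unk P.L0G 𝔏).card ≤ S.UcardC P := by
  unfold UcardC
  rw [S.card_unk, ← S.card_box]
  exact Nat.mul_le_mul_left _ (card_le_card h𝔏)

/-! ### Monotonicity of the closed forms -/

/-- `monDen` is monotone in the exponent box. [folklore] -/
theorem monDen_mono {E E' : Fin S.n → ℕ} (h : ∀ j, E j ≤ E' j) : MonomialDen.monDen S.α E ≤ MonomialDen.monDen S.α E' := by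
  unfold MonomialDen.monDen
  exact prod_le_prod' fun j _ => Nat.pow_le_pow_right (MonomialDen.one_le_qsize (S.α_ne j)) (h j)

/-- `monDen(α, L·|x|)` is monotone in `|x|`. [folklore] -/
theorem monDen_boxExpG_mono (L : Fin S.n → ℕ) {x x' : ℤ} (h : |x| ≤ |x'|) :
    MonomialDen.monDen S.α (S.boxExpG L x) ≤ MonomialDen.monDen S.α (S.boxExpG L x') := by
  refine S.monDen_mono fun j => ?_
  unfold boxExpG
  have : x.natAbs ≤ x'.natAbs := by
    have h1 : (x.natAbs : ℤ) ≤ x'.natAbs := by rwa [Int.natCast_natAbs, Int.natCast_natAbs]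
    exact_mod_cast h1
  exact Nat.mul_le_mul_left _ this

/-- `M0C` is monotone in `|x|` and in `t₀`. [folklore] -/
theorem M0C_mono (L₀ H Sh lev : ℕ) {x x' : ℤ} {t₀ t₀' : ℕ} (hx : |x| ≤ |x'|) (ht : t₀ ≤ t₀') :
    M0C L₀ H Sh lev x t₀ ≤ M0C L₀ H Sh lev x' t₀' := by
  unfold M0C
  refine Int.ceil_mono ?_
  have hb : (1 : ℝ) ≤ Real.exp 1 * (1 + |((2 ^ (Sh - lev) * x' : ℤ) : ℝ)| / H) := by
    have h1 : (1 : ℝ) ≤ Real.exp 1 := Real.one_le_exp zero_le_one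
    have : (0 : ℝ) ≤ |((2 ^ (Sh - lev) * x' : ℤ) : ℝ)| / H := by positivity
    nlinarith
  have hxx : |((2 ^ (Sh - lev) * x : ℤ) : ℝ)| ≤ |((2 ^ (Sh - lev) * x' : ℤ) : ℝ)| := by
    push_cast
    rw [abs_mul, abs_mul]
    exact mul_le_mul_of_nonneg_left (by exact_mod_cast hx) (abs_nonneg _)
  have hbase : Real.exp 1 * (1 + |((2 ^ (Sh - lev) * x : ℤ) : ℝ)| / H) ≤ Real.exp 1 * (1 + |((2 ^ (Sh - lev) * x' : ℤ) : ℝ)| / H) := by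
    gcongr
  have hν : (1 : ℝ) ≤ (Nat.lcmUpto H : ℝ) := by exact_mod_cast Nat.lcmUpto_pos H
  have hA : (2 : ℝ) ^ ((Sh - lev) * t₀) ≤ (2 : ℝ) ^ ((Sh - lev) * t₀') :=
    pow_le_pow_right₀ (by norm_num) (Nat.mul_le_mul_left _ ht)
  have hB : (Nat.lcmUpto H : ℝ) ^ t₀ ≤ (Nat.lcmUpto H : ℝ) ^ t₀' := pow_le_pow_right₀ hν ht
  have hC : (Real.exp 1 * (1 + |((2 ^ (Sh - lev) * x : ℤ) : ℝ)| / H)) ^ L₀ ≤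
      (Real.exp 1 * (1 + |((2 ^ (Sh - lev) * x' : ℤ) : ℝ)| / H)) ^ L₀ := pow_le_pow_left₀ (by positivity) hbase L₀
  have hE : (0 : ℝ) ≤ Real.exp (H / Real.exp 1) := (Real.exp_pos _).le
  exact mul_le_mul hA (mul_le_mul hB (mul_le_mul_of_nonneg_left hC hE) (by positivity) (by positivity)) (by positivity) (by positivity)

/-- `KC` is monotone in `#U`, `P`, `|x|` (for `0 ≤ P`). [folklore] -/
theorem KC_mono {U U' : ℕ} {Pc Pc' : ℤ} (hU : U ≤ U') (hP0 : 0 ≤ Pc) (hP : Pc ≤ Pc') (L₀ H Sh lev : ℕ) (L : Fin S.n → ℕ) {x x' : ℤ}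
    (hx : |x| ≤ |x'|) (τ : Tau S.n) :
    S.KC U Pc L₀ H Sh lev L x τ ≤ S.KC U' Pc' L₀ H Sh lev L x' τ := by
  unfold KC
  have hM : (0 : ℝ) ≤ M0C L₀ H Sh lev x τ.1 := by
    have h0 : (0 : ℤ) ≤ M0C L₀ H Sh lev x τ.1 := by unfold M0C; exact Int.ceil_nonneg (by positivity)
    exact_mod_cast h0
  have hMM : (M0C L₀ H Sh lev x τ.1 : ℝ) ≤ M0C L₀ H Sh lev x' τ.1 := by exact_mod_cast M0C_mono L₀ H Sh lev hx le_rfl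
  have hX : (0 : ℝ) ≤ S.XbC L := by
    have h0 : (0 : ℤ) ≤ S.XbC L := by
      unfold XbC
      exact mul_nonneg (by norm_num) (mul_nonneg (sum_nonneg fun j _ => abs_nonneg _) (sum_nonneg fun j _ => by positivity))
    exact_mod_cast h0
  have hmon : (MonomialDen.monDen S.α (S.boxExpG L x) : ℝ) ≤ MonomialDen.monDen S.α (S.boxExpG L x') := by
    exact_mod_cast monDen_boxExpG_mono S L hx
  have hP0' : (0 : ℝ) ≤ Pc := by exact_mod_cast hP0
  have hP' : (Pc : ℝ) ≤ Pc' := by exact_mod_cast hP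
  have hU' : (U : ℝ) ≤ U' := by exact_mod_cast hU
  have hfac : (M0C L₀ H Sh lev x τ.1 : ℝ) * (S.XbC L : ℝ) ^ (∑ k, τ.2 k) * ((MonomialDen.monDen S.α (S.boxExpG L x) : ℝ)) ^ 2 ≤
      (M0C L₀ H Sh lev x' τ.1 : ℝ) * (S.XbC L : ℝ) ^ (∑ k, τ.2 k) * ((MonomialDen.monDen S.α (S.boxExpG L x') : ℝ)) ^ 2 := by
    have hm0 : (0 : ℝ) ≤ (MonomialDen.monDen S.α (S.boxExpG L x) : ℝ) := by positivity
    exact mul_le_mul (mul_le_mul_of_nonneg_right hMM (by positivity)) (pow_le_pow_left₀ hm0 hmon 2) (by positivity)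
      (mul_nonneg (le_trans hM hMM) (by positivity))
  have hM' : (0 : ℝ) ≤ M0C L₀ H Sh lev x' τ.1 := le_trans hM hMM
  have h0' : 0 ≤ (M0C L₀ H Sh lev x' τ.1 : ℝ) * (S.XbC L : ℝ) ^ (∑ k, τ.2 k) * ((MonomialDen.monDen S.α (S.boxExpG L x') : ℝ)) ^ 2 := by
    positivity
  have hUP : (U : ℝ) * Pc ≤ (U' : ℝ) * Pc' := mul_le_mul hU' hP' hP0' (le_trans (Nat.cast_nonneg _) hU')
  have hUP0 : (0 : ℝ) ≤ (U : ℝ) * Pc := mul_nonneg (Nat.cast_nonneg _) hP0'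
  calc 1 + (U : ℝ) * Pc * ((M0C L₀ H Sh lev x τ.1 : ℝ) * (S.XbC L : ℝ) ^ (∑ k, τ.2 k) * ((MonomialDen.monDen S.α (S.boxExpG L x) : ℝ)) ^ 2)
      ≤ 1 + (U : ℝ) * Pc * ((M0C L₀ H Sh lev x' τ.1 : ℝ) * (S.XbC L : ℝ) ^ (∑ k, τ.2 k) * ((MonomialDen.monDen S.α (S.boxExpG L x') : ℝ)) ^ 2) := by
        linarith [mul_le_mul_of_nonneg_left hfac hUP0]
    _ ≤ 1 + (U' : ℝ) * Pc' * ((M0C L₀ H Sh lev x' τ.1 : ℝ) * (S.XbC L : ℝ) ^ (∑ k, τ.2 k) * ((MonomialDen.monDen S.α (S.boxExpG L x') : ℝ)) ^ 2) := by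
        linarith [mul_le_mul_of_nonneg_right hUP h0']

end G3Setup

end Summit.ABC.StewartYu

end
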